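import Literature.AlgebraicGeometry.Motives.BettiCycleClass
import Literature.AlgebraicGeometry.Motives.VarietiesProperProofs
import Literature.NumberTheory.Transcendental.AnalytificationChartsProofs
import Literature.NumberTheory.Transcendental.AnalytificationSeparatedProofs
import Literature.AlgebraicTopology.SingularHomology.CohomologyFiniteness
import Mathlib.Analysis.InnerProductSpace.PiL2
import Mathlib.Topology.Algebra.Module.FiniteDimension
import HarnessLib

/-!
# Discharged fact: the integral Betti cohomology of a smooth projective complex variety is
finitely generated (`bettiCohomologyInt_finite`)

`Literature.AlgebraicGeometry.Motives.BettiCycleClass` records as a named fact (D-0014)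
`Literature.AlgebraicGeometry.Motives.bettiCohomologyInt_finite : Prop` — for `X` smooth
projective of dimension `n` over `ℂ`, every `Hⁱ(X(ℂ); ℤ)` (singular cohomology of the complex
points with the strong topology) is a finitely generated abelian group — citing A. Hatcher,
*Algebraic Topology* (2002), App. A Cor. A.9 (a compact manifold is an ENR, hence has the
finitely generated homology of Cor. A.8) and §3.1 (universal coefficients). This file **proves**
it (`bettiCohomologyInt_finite_holds`) by assembling results of the tree:

1. `X(ℂ)` is a compact Hausdorff topological `2n`-manifold:
   * charts: `Literature.NumberTheory.Transcendental.exists_algebraicChart_holds X n` (Serre,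
     GAGA §2: holomorphic algebraic charts `X(ℂ) ⇀ ℂⁿ` at every point of a scheme smooth of
     relative dimension `n` and locally of finite type), composed with a real-linear
     homeomorphism `ℂⁿ ≃ₜ ℝ²ⁿ` (`ContinuousLinearEquiv.ofFinrankEq`), assembled into a
     `ChartedSpace (EuclideanSpace ℝ (Fin (2 * n)))` structure inside the proof;
   * compact: `compactSpace_algPoints_of_isProper_holds X ℂ` (Mumford I.10 Thm. 2) with
     `IsSmoothProjective.isProper_holds` (projective ⇒ proper);
   * Hausdorff: `ComplexPoints.t2Space_of_isSeparated` (proper ⇒ separated).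
2. The singular homology of a compact manifold is finitely generated
   (`finite_singularHomology_of_compact_chartedSpace`, Hatcher Cor. A.8–A.9, proved in
   `Literature.AlgebraicTopology.SingularHomology.CompactManifoldFiniteness` by Wilder's
   Mayer–Vietoris induction), hence so is singular cohomology with `ℤ` coefficients
   (`finite_singularCohomology_of_finite_singularHomology`, Hatcher §3.1 Cor. 3.3, proved in
   `…CohomologyFiniteness`) — packaged there as `finite_singularCohomology_of_compact_chartedSpace`.

No definitions; nothing of `BettiCycleClass.lean` is restated or modified.

## References

* A. Hatcher, *Algebraic Topology*, CUP 2002, App. A Cor. A.8–A.9 (p. 527), §3.1 Cor. 3.3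
  (p. 196). [HatcherAT2002]
* J.-P. Serre, *Géométrie algébrique et géométrie analytique*, Ann. Inst. Fourier 6 (1956), §2
  (the analytic space `X^h`: n°5 Prop. 2, n°6 Prop. 3 Cor. 2, n°7 Prop. 6). [SerreGAGA1956]
* C. Voisin, *Hodge Theory and Complex Algebraic Geometry I*, CUP 2002, §11.1.2 (integral Betti
  cohomology of a smooth projective variety). [VoisinHodgeI2002]
-/

noncomputable section

open CategoryTheory AlgebraicGeometry

namespace Literature.AlgebraicGeometry.Motives

/-- **Discharge of the named fact `Literature.AlgebraicGeometry.Motives.bettiCohomologyInt_finite`.**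
For `X` smooth projective of dimension `n` over `ℂ`, the integral Betti cohomology
`Hⁱ(X(ℂ); ℤ) = singularCohomology ℤ ℤ (ComplexPoints X) i` is a finitely generated abelian group
for every `i` (Hatcher 2002, App. A Cor. A.9 with Cor. A.8, and §3.1 Cor. 3.3; Voisin I, §11.1.2):
`X(ℂ)` is a compact (`X` proper) Hausdorff (`X` separated) topological `2n`-manifold (holomorphic
algebraic charts `X(ℂ) ⇀ ℂⁿ ≃ₜ ℝ²ⁿ`, Serre GAGA §2 n°5 Prop. 2), so
`finite_singularCohomology_of_compact_chartedSpace` over the principal ideal domain `ℤ`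
applies. [cite: HatcherAT2002, App. A Cor. A.9 and §3.1 Cor. 3.3] -/
theorem bettiCohomologyInt_finite_holds : bettiCohomologyInt_finite := by
  intro n X hX i
  -- `X(ℂ)` as a topological `2n`-manifold: algebraic charts followed by `ℂⁿ ≃ₜ ℝ²ⁿ`
  haveI := hX.smoothOfRelativeDimension
  haveI : Smooth X.hom := SmoothOfRelativeDimension.smooth n X.hom
  choose chart mem _ using fun P : ComplexPoints X ↦
    Literature.NumberTheory.Transcendental.exists_algebraicChart_holds X n P
  let eC : (Fin n → ℂ) ≃ₜ EuclideanSpace ℝ (Fin (2 * n)) :=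
    (ContinuousLinearEquiv.ofFinrankEq (𝕜 := ℝ) (by
      rw [Module.finrank_pi_fintype, finrank_euclideanSpace_fin]
      simp [Complex.finrank_real_complex, mul_comm])).toHomeomorph
  letI : ChartedSpace (EuclideanSpace ℝ (Fin (2 * n))) (ComplexPoints X) :=
    { atlas := Set.range fun P ↦ (chart P).transHomeomorph eC
      chartAt := fun P ↦ (chart P).transHomeomorph eC
      mem_chart_source := fun P ↦ by
        rw [OpenPartialHomeomorph.transHomeomorph_source]; exact mem P
      chart_mem_atlas := fun P ↦ ⟨P, rfl⟩ }
  -- compact (proper) and Hausdorff (separated)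
  haveI : IsProper X.hom := IsSmoothProjective.isProper_holds hX
  haveI : CompactSpace (ComplexPoints X) := compactSpace_algPoints_of_isProper_holds X ℂ
  haveI : T2Space (ComplexPoints X) := ComplexPoints.t2Space_of_isSeparated X
  exact Literature.AlgebraicTopology.SingularHomology.finite_singularCohomology_of_compact_chartedSpace
    ℤ ℤ (d := 2 * n) i

end Literature.AlgebraicGeometry.Motives
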